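import Summits.CriticalPhenomena.CardyFormulaZ2.Theorems.CardyComplexConeEdgePrecompactEnvelopeFromLocal
import Summits.CriticalPhenomena.CardyFormulaZ2.Theorems.CardyComplexConeEdgePrecompactVertexRelation
import Summits.CriticalPhenomena.CardyFormulaZ2.Theorems.CardyComplexConeEdgePrecompactUFRSStrands
import Literature.Probability.Percolation.ZdOneArmPowerBound
import Literature.Probability.Percolation.KestenTheorem

/-!
# The linear local envelope at an RSW exponent (unconditional)
(line `qkz-strip-boundary-arm` of crux `CardyComplexCone.EdgePrecompact`, stmt-CriticalPhenomena-11387;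
registered sub-goal `linearLocalEnvelope_rsw` with its rider `localInnerEnvelopeUI_rsw`)

The registered open core of the line, `stub_localInnerEnvelopeUI` (X1), is the local envelope of the
spin-`1/3` dart phase sum `F_{v,f}` of the medial exploration (`cornerObs = ∫ F`) at the SHARP exponent
`1/3`: `‖E[F_{v,f} ; A]‖ ≤ ε₁ (E.δ/ρ)^{1/3}` for events `A` measurable off the ball `B(δv, ρ) ⊆ E.Ω` of
small probability. This file proves the same statement UNCONDITIONALLY with `1/3` replaced by an RSW
exponent `α > 0`, in the stronger LINEAR form `‖E[F_{v,f} ; A]‖ ≤ C · P(A) · (E.δ/ρ)^α`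
(`linearLocalEnvelope_rsw`), and in the tail form verbatim (`localInnerEnvelopeUI_rsw`,
`ε' = ε₁ / (|C| + 1)`): the open content of (X1) is exactly the VALUE of the exponent.

Proof. `‖F‖ ≤ 1` (`norm_dartPhaseSum_le_one`) and `F(ω) ≠ 0` only if the exploration visits the corner
before its exit time (`dartPhaseSum_eq_orbitSum`). A visit produces, on the left of the exploration, a
walk of open edges of the completed configuration from the start vertex (a site of the arc `A`, NOT deep
in the ball: `not_mem_zdBoundary_of_deep`) to `v` (`exists_leftWalk`); stopped at its first exit from
the box `v + B(n)`, `n ≍ ρ/(4δ)` (`exists_mem_innerBoundary_openConnIn`), it is an open path of `ω`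
itself (`mem_bcBondConfig_iff_of_deep`; the sites of the ball are sites of `Ω_δ`, being joined to
`v ∈ Ω_δ` through the ball): `ω ∈ shiftedOneArm 2 n v`. That event reads only pairs of sites of the box,
whose midpoints lie in the ball, so it is independent of `A` (`bondPercolation_indep_edgeSigma`,
Grimmett 1999 §2.2): `‖E[F ; A]‖ ≤ P(A ∩ arm) = P(A) P(arm) ≤ P(A) · C₁ n^{-α}` (translation invariance
`real_shiftedOneArm`; Nolin 2008, Prop. 14, `exists_real_boxToFar_le_rpow_of_le_half`).

References: G. Grimmett, *Percolation* (1999), §2.2, §11; P. Nolin, Electron. J. Probab. 13 (2008), §4;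
S. Smirnov, C. R. Acad. Sci. Paris 333 (2001), §2; H. Duminil-Copin, S. Smirnov, Clay Math. Proc. 15
(2012), §8, Conj. 8.7.
-/


namespace Summit.CriticalPhenomena.CardyFormulaZ2.Cruxes.EdgePrecompact.QkzStripBoundaryArm

open MeasureTheory Filter Set Metric
open scoped Topology BigOperators Pointwise
open Literature.Probability.LatticeModels Literature.Probability.Percolation
open Literature.Probability.RandomPlanarGeometry (DobrushinDomain)
open Summit.CriticalPhenomena.CardyFormulaZ2.Theses.CardyComplexCone

noncomputable section

/-! ## Lattice geometry of the box `v + B(n)` -/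

/-- Sites of the centred box `B(n)` have mesh points of norm `≤ 2δn`. -/
private theorem norm_meshPoint_le_R4 {δ : ℝ} (hδ : 0 ≤ δ) {z : Site 2} {n : ℕ} (hz : z ∈ box 2 n) :
    ‖meshPoint δ z‖ ≤ 2 * δ * n := by
  refine (Complex.norm_le_abs_re_add_abs_im _).trans ?_
  rw [meshPoint_re, meshPoint_im, abs_mul, abs_mul, abs_of_nonneg hδ]
  obtain ⟨h0, h1⟩ := And.intro ((mem_box.1 hz) 0) ((mem_box.1 hz) 1)
  have h0' : |((z 0 : ℤ) : ℝ)| ≤ n := abs_le.2 ⟨by exact_mod_cast h0.1, by exact_mod_cast h0.2⟩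
  have h1' : |((z 1 : ℤ) : ℝ)| ≤ n := abs_le.2 ⟨by exact_mod_cast h1.1, by exact_mod_cast h1.2⟩
  nlinarith

/-- Sites of the translated box `v + B(n)` have mesh points within `2δn` of `δv`. -/
private theorem dist_le_of_mem_shiftBox_R4 {δ : ℝ} (hδ : 0 ≤ δ) {v a : Site 2} {n : ℕ}
    (ha : a ∈ (box 2 n).image (· + v)) : dist (meshPoint δ a) (meshPoint δ v) ≤ 2 * δ * n := by
  obtain ⟨z, hz, rfl⟩ := Finset.mem_image.1 ha
  rw [meshPoint_add_shift, dist_eq_norm, add_sub_cancel_left]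
  exact norm_meshPoint_le_R4 hδ hz

/-- A site whose mesh point is within `δm` of `δv` lies in the translated box `v + B(m)`. -/
private theorem sub_mem_box_of_dist_lt_R4 {δ : ℝ} (hδ : 0 < δ) {v x : Site 2} {m : ℕ}
    (h : dist (meshPoint δ x) (meshPoint δ v) < δ * m) : x - v ∈ box 2 m := by
  rw [dist_eq_norm] at h
  have hre := (Complex.abs_re_le_norm (meshPoint δ x - meshPoint δ v)).trans_lt h
  have him := (Complex.abs_im_le_norm (meshPoint δ x - meshPoint δ v)).trans_lt h
  rw [Complex.sub_re, meshPoint_re, meshPoint_re, ← mul_sub, abs_mul, abs_of_pos hδ] at hre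
  rw [Complex.sub_im, meshPoint_im, meshPoint_im, ← mul_sub, abs_mul, abs_of_pos hδ] at him
  have h0 : |x 0 - v 0| < (m : ℤ) := by
    have h' := lt_of_mul_lt_mul_left hre hδ.le
    exact_mod_cast h'
  have h1 : |x 1 - v 1| < (m : ℤ) := by
    have h' := lt_of_mul_lt_mul_left him hδ.le
    exact_mod_cast h'
  rw [abs_lt] at h0 h1
  simp only [mem_box, Fin.forall_fin_two, Pi.sub_apply]
  omega

/-- Pairs of sites of the translated box `v + B(n)` have their midpoints within `2δn` of `δv`:
for `2δn < ρ` they lie in the ball `B(δv, ρ)`. -/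
private theorem medialPoint_mem_ball_of_mem_sym2_R4 {δ ρ : ℝ} (hδ : 0 ≤ δ) {v : Site 2} {n : ℕ}
    (hn : 2 * δ * n < ρ) {e : Sym2 (Site 2)} (he : e ∈ ((box 2 n).image (· + v)).sym2) :
    medialPoint δ e ∈ ball (meshPoint δ v) ρ := by
  induction e using Sym2.ind with
  | h a b =>
    rw [Finset.mk_mem_sym2_iff] at he
    have ha := dist_le_of_mem_shiftBox_R4 hδ he.1
    have hb := dist_le_of_mem_shiftBox_R4 hδ he.2
    rw [dist_eq_norm] at ha hb
    rw [mem_ball, medialPoint_mk, dist_eq_norm]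
    have hrw : (meshPoint δ a + meshPoint δ b) / 2 - meshPoint δ v =
        ((meshPoint δ a - meshPoint δ v) + (meshPoint δ b - meshPoint δ v)) / 2 := by ring
    rw [hrw, norm_div, Complex.norm_two]
    have := norm_add_le (meshPoint δ a - meshPoint δ v) (meshPoint δ b - meshPoint δ v)
    linarith

/-- A lattice walk all of whose edges are open is an open path. -/
private theorem reachable_openGraph_of_walk_R4 {ω : BondConfig (Site 2)} {x y : Site 2}
    (W : (zdGraph 2).Walk x y) (h : ∀ e ∈ W.edges, e ∈ ω) : (openGraph ω).Reachable x y := by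
  induction W with
  | nil => rfl
  | cons hadj W ih =>
    refine (SimpleGraph.Adj.reachable ?_).trans (ih fun e he => h e (by simp [he]))
    rw [openGraph_adj]
    exact ⟨h _ (by simp), hadj.ne⟩

/-! ## The sites of a ball inside `Ω` around a site of `Ω_δ` are sites of `Ω_δ` -/

/-- `Ω_δ`, a union of whole connected components of the mesh graph on mesh vertices, is closed under
mesh-graph neighbours that are mesh vertices (the tree's `mem_meshDomain_of_meshGraph_adj` of
`BoxCrossingProofs.lean`, restated to keep the imports of this file small). -/
private theorem mem_meshDomain_of_meshGraph_adj_R4 {Ω : Set ℂ} {δ : ℝ} {x y : Site 2}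
    (hx : x ∈ meshDomain Ω δ) (hy : y ∈ meshVertices Ω δ) (hxy : (meshGraph Ω δ).Adj x y) :
    y ∈ meshDomain Ω δ := by
  -- adapted from `Literature.Probability.Percolation.mem_meshDomain_of_meshGraph_adj`
  simp only [meshDomain, mem_iUnion, mem_image] at hx ⊢
  obtain ⟨C, hC, x', hx'C, rfl⟩ := hx
  refine ⟨C, hC, ⟨y, hy⟩, ?_, rfl⟩
  rw [SimpleGraph.ConnectedComponent.mem_supp_iff] at hx'C ⊢
  rw [← hx'C]
  exact SimpleGraph.ConnectedComponent.sound
    (SimpleGraph.Adj.reachable (show (meshVertexGraph Ω δ).Adj ⟨y, hy⟩ x' from hxy.symm))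

/-- **The ball is made of sites of the discrete domain.** If `closedBall (δv) ρ ⊆ E.Ω`, `v ∈ Ω_δ` and
`2δm ≤ ρ`, every site of the box `v + B(m)` belongs to `Ω_δ` (it is joined to `v` by a lattice path in
the box, whose closed mesh edges lie in the ball, hence in `closure Ω`; `Ω_δ` is a union of mesh
components, `mem_meshDomain_of_meshGraph_adj_R4`). -/
private theorem add_mem_meshDomain_of_mem_box_R4 {E : DiscreteDobrushin} (hδ : 0 ≤ E.δ) {v : Site 2}
    {m : ℕ} {ρ : ℝ} (hmρ : 2 * E.δ * m ≤ ρ) (hball : closedBall (meshPoint E.δ v) ρ ⊆ E.Ω)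
    (hv : v ∈ meshDomain E.Ω E.δ) {z : Site 2} (hz : z ∈ box 2 m) : z + v ∈ meshDomain E.Ω E.δ := by
  have hin : ∀ a ∈ box 2 m, meshPoint E.δ (a + v) ∈ closedBall (meshPoint E.δ v) ρ := fun a ha => by
    rw [mem_closedBall, meshPoint_add_shift, dist_eq_norm, add_sub_cancel_left]
    exact (norm_meshPoint_le_R4 hδ ha).trans hmρ
  have step : ∀ a c : Site 2, a ∈ box 2 m → c ∈ box 2 m → (zdGraph 2).Adj c a →
      c + v ∈ meshDomain E.Ω E.δ → a + v ∈ meshDomain E.Ω E.δ := fun a c ha hc hadj hcM =>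
    mem_meshDomain_of_meshGraph_adj_R4 hcM (mem_meshVertices_iff.2 (hball (hin a ha)))
      (meshGraph_adj_iff.2 ⟨(zdGraph_adj_shift_iff v c a).2 hadj,
        ((convex_closedBall _ _).segment_subset (hin c hc) (hin a ha)).trans (hball.trans subset_closure)⟩)
  obtain ⟨W⟩ := box_induce_reachable_zero m hz
  suffices H : ∀ (a b : ↥(↑(box 2 m) : Set (Site 2))) (_ : ((zdGraph 2).induce ↑(box 2 m)).Walk a b),
      (b : Site 2) + v ∈ meshDomain E.Ω E.δ → (a : Site 2) + v ∈ meshDomain E.Ω E.δ by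
    exact H _ _ W (by simpa using hv)
  intro a b W'
  induction W' with
  | nil => exact id
  | @cons a c _ h _ ih => exact fun hb => step a c a.2 c.2 (SimpleGraph.comap_adj.1 h).symm (ih hb)

/-! ## A visit of the corner forces an arm of `ω` in the box -/

/-- **A visit of the corner produces an open arm of `ω` in the box `v + B(n)`.** Admissible data, a
corner `(v, f)` with `f = faceAt v k`, a ball `closedBall (δv) ρ ⊆ E.Ω`, scales `2δm ≤ ρ`,
`2n + 9 ≤ m`, and a LATTICE configuration `ω` whose exploration visits the coded corner `(v, k)`
before its exit time. Then `ω ∈ shiftedOneArm 2 n v`: the open left walk of the completed configuration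
from the start vertex to `v` (`exists_leftWalk`), stopped at its first exit from the box
(`exists_mem_innerBoundary_openConnIn`; the start vertex lies on the arc `A`, outside the box by
`not_mem_zdBoundary_of_deep`), is an open path of `ω` inside the box (`mem_bcBondConfig_iff_of_deep`,
`PlanarDuality.determinedBy_openConnIn`). The depth hypothesis of those lemmas holds at radius `δm`
about `δv` because every site of `v + B(m)` is a site of `Ω_δ` (`v ∈ Ω_δ` as a corner of the inner
face `f`). -/
theorem shiftedOneArm_of_cornerOrbit_eq {E : DiscreteDobrushin} (hE : E.IsZdAdmissible) {v f : Site 2}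
    (hvf : IsCorner v f) {ρ : ℝ} (hball : closedBall (meshPoint E.δ v) ρ ⊆ E.Ω) {m n : ℕ}
    (hmρ : 2 * E.δ * m ≤ ρ) (hnm : 2 * n + 9 ≤ m) {ω : BondConfig (Site 2)} (hω : ω ⊆ (zdGraph 2).edgeSet)
    {k : Fin 4} (hfk : f = faceAt v k) {j : ℕ} (hj : j < DiscreteDobrushin.exitTime hE ω)
    (hjq : cornerOrbit (E.bcBondConfig ω) (DiscreteDobrushin.startCorner hE) j = (v, k)) :
    ω ∈ shiftedOneArm 2 n v := by
  set β := E.bcBondConfig ω with hβdef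
  set c := DiscreteDobrushin.startCorner hE with hcdef
  have hδ : 0 < E.δ := hE.delta_pos
  have hnm' : (2 * n + 9 : ℝ) ≤ m := by exact_mod_cast hnm
  have hn' : 2 * E.δ * n + 9 * E.δ ≤ E.δ * m := by nlinarith
  -- `v` is a site of the discrete domain: its face `f` is inner (visited before the exit time)
  have hface := DiscreteDobrushin.isInnerFace_of_lt_exitTime hE ω hj
  rw [hjq] at hface
  have hvM : v ∈ meshDomain E.Ω E.δ := mem_meshDomain_of_isCorner_of_isInnerFace hvf (hfk ▸ hface)
  -- depth: every lattice edge at a site within `δm` of `δv` is an edge of `Ω_δ`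
  have hdeep : ∀ x y : Site 2, dist (meshPoint E.δ x) (meshPoint E.δ v) < E.δ * m → (zdGraph 2).Adj x y →
      (discreteDomainGraph E.Ω E.δ).Adj x y := by
    intro x y hx hxy
    have hxM : x ∈ meshDomain E.Ω E.δ := by
      have h := add_mem_meshDomain_of_mem_box_R4 hδ.le hmρ hball hvM (sub_mem_box_of_dist_lt_R4 hδ hx)
      rwa [sub_add_cancel] at h
    obtain ⟨k', rfl⟩ := exists_eq_add_cornerUnit hxy
    have hy1 := dist_meshPoint_add_cornerUnit_le hδ.le x k'
    have hxball : meshPoint E.δ x ∈ closedBall (meshPoint E.δ v) ρ := mem_closedBall.2 (by nlinarith)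
    have hyball : meshPoint E.δ (x + cornerUnit k') ∈ closedBall (meshPoint E.δ v) ρ := by
      have h2 := dist_triangle (meshPoint E.δ (x + cornerUnit k')) (meshPoint E.δ x) (meshPoint E.δ v)
      exact mem_closedBall.2 (by nlinarith)
    have hmesh : (meshGraph E.Ω E.δ).Adj x (x + cornerUnit k') := meshGraph_adj_iff.2 ⟨hxy,
      ((convex_closedBall _ _).segment_subset hxball hyball).trans (hball.trans subset_closure)⟩
    exact discreteDomainGraph_adj_iff.2 ⟨hmesh, hxM,
      mem_meshDomain_of_meshGraph_adj_R4 hxM (mem_meshVertices_iff.2 (hball hyball)) hmesh⟩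
  -- the box `Λ = v + B(n)`
  set Λ : Finset (Site 2) := (box 2 n).image (· + v) with hΛdef
  have hΛdist : ∀ a ∈ Λ, dist (meshPoint E.δ a) (meshPoint E.δ v) ≤ 2 * E.δ * n := fun a ha =>
    dist_le_of_mem_shiftBox_R4 hδ.le ha
  have hvΛ : v ∈ Λ := Finset.mem_image.2 ⟨0, zero_mem_box 2 n, zero_add v⟩
  -- the start vertex lies on the arc `A`, hence outside `Λ`
  have hcΛ : c.1 ∉ Λ := fun hc =>
    not_mem_zdBoundary_of_deep hdeep hδ.le (by linarith [hΛdist _ hc])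
      (E.zdArcA_subset_zdBoundary (DiscreteDobrushin.isStartCorner_startCorner hE).mem_zdArcA)
  -- the open left walk of `β` from the start vertex to `v`
  obtain ⟨W, -, hWe⟩ := exists_leftWalk β c 0 j (Nat.zero_le j)
  have hreach := reachable_openGraph_of_walk_R4 W (fun e he => by
    obtain ⟨t, -, -, rfl, ht⟩ := hWe e he
    exact ht)
  rw [hjq] at hreach
  have hβ : β ⊆ (zdGraph 2).edgeSet := fun e he =>
    SimpleGraph.edgeSet_subset_edgeSet.2
      ((discreteDomainGraph_le_meshGraph E.Ω E.δ).trans (meshGraph_le_zdGraph E.Ω E.δ)) (E.bcBondConfig_subset ω he)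
  -- stopped at its first exit from `Λ`
  obtain ⟨z, hz, hconn⟩ := exists_mem_innerBoundary_openConnIn hβ Λ hvΛ hcΛ hreach.symm
  -- inside `Λ` the completed configuration is `ω`
  have key : ∀ e ∈ Λ.sym2, (e ∈ β ↔ e ∈ ω) := by
    intro e he
    by_cases hedge : e ∈ (zdGraph 2).edgeSet
    · obtain ⟨⟨x, k'⟩, rfl⟩ := exists_eq_cSrc hedge
      have hx : x ∈ Λ := Finset.mem_sym2_iff.1 he x (Sym2.mem_mk_left _ _)
      exact mem_bcBondConfig_iff_of_deep hdeep hδ.le k' (by linarith [hΛdist x hx]) ω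
    · exact ⟨fun h => absurd (hβ h) hedge, fun h => absurd (hω h) hedge⟩
  have hconnω : ω ∈ openConnIn (↑Λ : Set (Site 2)) v z :=
    ((determinedBy_iff _ _).1 (PlanarDuality.determinedBy_openConnIn Λ v z) β ω
      (Set.ext fun e => ⟨fun h => ⟨(key e h.2).1 h.1, h.2⟩, fun h => ⟨(key e h.2).2 h.1, h.2⟩⟩)).1 hconn
  -- which is the translated one-arm event
  rw [innerBoundary_image_add_right] at hz
  rw [hΛdef, Finset.coe_image] at hconnω
  exact ⟨v, ⟨0, rfl, zero_add v⟩, z, by simpa only [Finset.coe_image] using Finset.mem_coe.2 hz, hconnω⟩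

/-- Sites of the inner vertex boundary of `B(n)`, `n ≥ 1`, are not in `B(n - 1)`. -/
private theorem not_mem_box_pred_of_mem_innerBoundary_R4 {n : ℕ} (hn : 1 ≤ n) {y : Site 2}
    (hy : y ∈ innerBoundary (zdGraph 2) (box 2 n)) : y ∉ box 2 (n - 1) := by
  obtain ⟨-, y', hy', hadj⟩ := mem_innerBoundary_iff.1 hy
  intro hyn
  apply hy'
  obtain ⟨k, rfl⟩ := exists_eq_add_cornerUnit hadj
  have hk : ∀ (k : Fin 4) (i : Fin 2), -1 ≤ cornerUnit k i ∧ cornerUnit k i ≤ 1 := by decide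
  rw [mem_box] at hyn ⊢
  exact fun i => by have h1 := hyn i; have h2 := hk k i; simp only [Pi.add_apply]; omega

/-! ## The stub and its rider -/

/-- **The linear local envelope at an RSW exponent** (registered sub-goal `linearLocalEnvelope_rsw` of
stmt-CriticalPhenomena-11387, line `qkz-strip-boundary-arm`; unconditional). There are `C` and `α > 0`
such that for every admissible datum `E`, corner `(v, f)`, radius `ρ ≥ E.δ` with
`closedBall (δv) ρ ⊆ E.Ω` and every event `A` measurable off the ball `B(δv, ρ)`,
`‖∫_A F_{v,f} dP_{1/2}‖ ≤ C · P(A) · (E.δ/ρ)^α`, `F_{v,f}` the spin-`1/3` dart phase sum of the medial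
exploration. Proof: `|F| ≤ 1_{arm}` a.e. with the arm event of `ω` in the box `v + B(n)`, `n ≍ ρ/(4δ)`
(`shiftedOneArm_of_cornerOrbit_eq`), independent of `A` (disjoint edge sets, Grimmett 1999 §2.2), of
probability `≤ C₁ n^{-α}` (Nolin 2008, Prop. 14, `exists_real_boxToFar_le_rpow_of_le_half`, and
translation invariance); radii `ρ < 52 δ` are covered by `‖∫_A F‖ ≤ P(A)`. -/
theorem linearLocalEnvelope_rsw : ∃ C α : ℝ, 0 < α ∧ ∀ (E : DiscreteDobrushin), E.IsZdAdmissible → ∀ v f : Site 2, IsCorner v f → ∀ ρ : ℝ, E.δ ≤ ρ → closedBall (meshPoint E.δ v) ρ ⊆ E.Ω → ∀ A : Set (BondConfig (Site 2)), MeasurableSet[MeasurableSpace.comap (fun ω : BondConfig (Site 2) => ω \ {e | medialPoint E.δ e ∈ ball (meshPoint E.δ v) ρ}) (inferInstance : MeasurableSpace (BondConfig (Site 2)))] A → ‖∫ ω in A, dartPhaseSum (medialExploration E ω) E.δ (1 / 3) (v, f) ∂(bondPercolation (zdGraph 2) half)‖ ≤ C * (bondPercolation (zdGraph 2) half).real A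 * (E.δ / ρ) ^ α := by
  obtain ⟨C₁, α, hC₁, hα, harm⟩ := exists_real_boxToFar_le_rpow_of_le_half
  refine ⟨C₁ * 8 ^ α + 52 ^ α, α, hα, fun E hE v f hvf ρ hρ hball A hA => ?_⟩
  set μ := bondPercolation (zdGraph 2) half with hμ
  set T : Set (Sym2 (Site 2)) := {e | medialPoint E.δ e ∈ ball (meshPoint E.δ v) ρ} with hT
  set F : BondConfig (Site 2) → ℂ := fun ω => dartPhaseSum (medialExploration E ω) E.δ (1 / 3) (v, f) with hF
  have hδ : 0 < E.δ := hE.delta_pos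
  have hρpos : 0 < ρ := lt_of_lt_of_le hδ hρ
  have hr0 : 0 ≤ E.δ / ρ := div_nonneg hδ.le hρpos.le
  have hrpow : 0 ≤ (E.δ / ρ) ^ α := Real.rpow_nonneg hr0 _
  have hP0 : 0 ≤ μ.real A := measureReal_nonneg
  have h8 : 0 ≤ C₁ * (8 : ℝ) ^ α := mul_nonneg hC₁.le (Real.rpow_nonneg (by norm_num) _)
  have h52 : 0 ≤ (52 : ℝ) ^ α := Real.rpow_nonneg (by norm_num) _
  -- `A` is measurable for the σ-algebra of the edges off the ball; `‖F‖ ≤ 1` and the trivial bound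
  have hAσ : MeasurableSet[edgeSigma Tᶜ] A := comap_inter_le_edgeSigma Tᶜ A hA
  have hF1 : ∀ ω, ‖F ω‖ ≤ 1 := fun ω =>
    norm_dartPhaseSum_le_one (nodup_zip_tail_medialExploration E ω) E.δ (1 / 3) (v, f)
  have htriv : ‖∫ ω in A, F ω ∂μ‖ ≤ μ.real A := by
    have h := norm_setIntegral_le_of_norm_le_const (measure_lt_top μ A) (fun ω _ => hF1 ω)
    rwa [one_mul] at h
  by_cases hdeg : ρ < 52 * E.δ
  · -- small radius: the trivial bound
    have h1 : (1 : ℝ) ≤ 52 ^ α * (E.δ / ρ) ^ α := by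
      rw [← Real.mul_rpow (by norm_num) hr0]
      refine Real.one_le_rpow ?_ hα.le
      rw [mul_div_assoc', le_div_iff₀ hρpos]
      linarith
    calc ‖∫ ω in A, F ω ∂μ‖ ≤ μ.real A := htriv
      _ ≤ μ.real A * (52 ^ α * (E.δ / ρ) ^ α) := le_mul_of_one_le_right hP0 h1
      _ = 52 ^ α * μ.real A * (E.δ / ρ) ^ α := by ring
      _ ≤ (C₁ * 8 ^ α + 52 ^ α) * μ.real A * (E.δ / ρ) ^ α :=
          mul_le_mul_of_nonneg_right (mul_le_mul_of_nonneg_right (by linarith) hP0) hrpow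
  · push Not at hdeg
    -- the scales `m = ⌊ρ/(2δ)⌋ ≥ 26`, `n = ⌊(m - 9)/2⌋ ≥ 8`
    set m : ℕ := ⌊ρ / (2 * E.δ)⌋₊ with hm
    have hm1 : (m : ℝ) ≤ ρ / (2 * E.δ) := Nat.floor_le (by positivity)
    have hm2 : ρ / (2 * E.δ) < m + 1 := Nat.lt_floor_add_one _
    have hmρ : 2 * E.δ * m ≤ ρ := by linarith [(le_div_iff₀ (by positivity)).1 hm1]
    have hρm : ρ < (m + 1) * (2 * E.δ) := (div_lt_iff₀ (by positivity)).1 hm2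
    have h26 : (26 : ℝ) ≤ ρ / (2 * E.δ) := by rw [le_div_iff₀ (by positivity)]; linarith
    have hm25 : 25 < m := by exact_mod_cast (show (25 : ℝ) < m by linarith)
    set n : ℕ := (m - 9) / 2 with hn
    have hnm : 2 * n + 9 ≤ m := by omega
    have hmn : m ≤ 2 * n + 10 := by omega
    have hn8 : 8 ≤ n := by omega
    have h2 : (m : ℝ) ≤ 2 * n + 10 := by exact_mod_cast hmn
    have h3 : (8 : ℝ) ≤ n := by exact_mod_cast hn8
    have hn2 : 2 * E.δ * n < ρ := by
      have h : (n : ℝ) + 1 ≤ m := by exact_mod_cast (show n + 1 ≤ m by omega)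
      nlinarith
    -- `1/(n-1) ≤ 8 δ/ρ`
    have hratio : ((1 : ℕ) : ℝ) / ((n - 1 : ℕ) : ℝ) ≤ 8 * (E.δ / ρ) := by
      have hn1' : ((n - 1 : ℕ) : ℝ) = n - 1 := by rw [Nat.cast_sub (by omega), Nat.cast_one]
      have hnpos : (0 : ℝ) < n - 1 := by linarith
      have e1 : (m : ℝ) * E.δ ≤ (2 * n + 10) * E.δ := mul_le_mul_of_nonneg_right h2 hδ.le
      have e2 : (8 : ℝ) * E.δ ≤ n * E.δ := mul_le_mul_of_nonneg_right h3 hδ.le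
      have key : ρ ≤ 8 * E.δ * ((n : ℝ) - 1) := by nlinarith
      rwa [Nat.cast_one, hn1', div_le_iff₀ hnpos,
        show 8 * (E.δ / ρ) * ((n : ℝ) - 1) = 8 * E.δ * ((n : ℝ) - 1) / ρ by ring, le_div_iff₀ hρpos, one_mul]
    -- the arm event: measurable off `A`'s edges, independent of `A`, of small probability
    set Λ : Finset (Site 2) := (box 2 n).image (· + v) with hΛ
    set Arm : Set (BondConfig (Site 2)) := shiftedOneArm 2 n v with hArm
    have hArm_m : MeasurableSet Arm := measurableSet_openCrossing_image (box 2 n) v _ _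
    have hArmσ : MeasurableSet[edgeSigma (↑Λ.sym2 : Set (Sym2 (Site 2)))] Arm :=
      (determinedBy_openCrossing_image (box 2 n) v _ _).measurableSet_edgeSigma hArm_m
    have hKT : (↑Λ.sym2 : Set (Sym2 (Site 2))) ⊆ T := fun e he =>
      medialPoint_mem_ball_of_mem_sym2_R4 hδ.le hn2 he
    have hind : μ (A ∩ Arm) = μ A * μ Arm :=
      (ProbabilityTheory.Indep_iff _ _ _).1
        (bondPercolation_indep_edgeSigma (zdGraph 2) half (Set.disjoint_compl_left_iff_subset.2 hKT))
        A Arm hAσ hArmσ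
    have hArmP : μ.real Arm ≤ C₁ * (8 ^ α * (E.δ / ρ) ^ α) := by
      rw [hArm, real_shiftedOneArm]
      have hsub : siteToBoundary 2 n ⊆
          {ω | ∃ x ∈ box 2 1, ∃ y ∉ box 2 (n - 1), ω ∈ openConnIn Set.univ x y} := by
        rintro ω ⟨y, hy, hconn⟩
        exact ⟨0, zero_mem_box 2 1, y, not_mem_box_pred_of_mem_innerBoundary_R4 (by omega) hy,
          openConnIn_mono (Set.subset_univ _) _ _ hconn⟩
      calc μ.real (siteToBoundary 2 n)
          ≤ μ.real {ω | ∃ x ∈ box 2 1, ∃ y ∉ box 2 (n - 1), ω ∈ openConnIn Set.univ x y} :=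
            measureReal_mono hsub
        _ ≤ C₁ * (((1 : ℕ) : ℝ) / ((n - 1 : ℕ) : ℝ)) ^ α := harm half (by simp) 1 (n - 1) le_rfl (by omega)
        _ ≤ C₁ * (8 ^ α * (E.δ / ρ) ^ α) := by
            rw [← Real.mul_rpow (by norm_num) hr0]
            exact mul_le_mul_of_nonneg_left (Real.rpow_le_rpow (by positivity) hratio hα.le) hC₁.le
    -- off the arm event the phase sum vanishes (for lattice configurations, i.e. a.e.)
    obtain ⟨k, hfk⟩ := exists_faceAt_of_isCorner hvf
    have hzero : ∀ ω : BondConfig (Site 2), ω ⊆ (zdGraph 2).edgeSet → ω ∉ Arm → F ω = 0 := by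
      intro ω hω hnot
      by_contra hne
      have hsum := dartPhaseSum_eq_orbitSum hE ω (v, k)
      simp only [cFace] at hsum
      rw [← hfk] at hsum
      simp only [hF, hsum] at hne
      obtain ⟨j, hj, -⟩ := Finset.exists_ne_zero_of_sum_ne_zero hne
      rw [Finset.mem_filter, Finset.mem_range] at hj
      exact hnot (shiftedOneArm_of_cornerOrbit_eq hE hvf hball hmρ hnm hω hfk hj.1 hj.2)
    have hae : ∀ᵐ ω ∂μ, ‖F ω‖ ≤ Arm.indicator (fun _ => (1 : ℝ)) ω := by
      filter_upwards [ae_subset_edgeSet (zdGraph 2) half] with ω hω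
      by_cases hωA : ω ∈ Arm
      · rw [Set.indicator_of_mem hωA]
        exact hF1 ω
      · rw [Set.indicator_of_notMem hωA, hzero ω hω hωA, norm_zero]
    -- the integral estimate
    have hFint : Integrable F μ := integrable_dartPhaseSum_medialExploration hE E.δ (1 / 3) (v, f)
    calc ‖∫ ω in A, F ω ∂μ‖ ≤ ∫ ω in A, ‖F ω‖ ∂μ := norm_integral_le_integral_norm _
      _ ≤ ∫ ω in A, Arm.indicator (fun _ => (1 : ℝ)) ω ∂μ :=
          setIntegral_mono_ae hFint.norm.integrableOn ((integrable_const (1 : ℝ)).indicator hArm_m).integrableOn hae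
      _ = μ.real (A ∩ Arm) := by
          rw [setIntegral_indicator hArm_m, setIntegral_const, smul_eq_mul, mul_one]
      _ = μ.real A * μ.real Arm := by
          rw [measureReal_def, hind, ENNReal.toReal_mul]
          rfl
      _ ≤ μ.real A * (C₁ * (8 ^ α * (E.δ / ρ) ^ α)) := mul_le_mul_of_nonneg_left hArmP hP0
      _ = C₁ * 8 ^ α * μ.real A * (E.δ / ρ) ^ α := by ring
      _ ≤ (C₁ * 8 ^ α + 52 ^ α) * μ.real A * (E.δ / ρ) ^ α :=
          mul_le_mul_of_nonneg_right (mul_le_mul_of_nonneg_right (by linarith) hP0) hrpow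

/-- **(X1) at an RSW exponent** (registered rider `localInnerEnvelopeUI_rsw` of
stmt-CriticalPhenomena-11387): the registered stub `stub_localInnerEnvelopeUI` verbatim with the sharp
exponent `1/3` replaced by an RSW exponent `α > 0` — for every `ε₁ > 0` there is `ε' > 0` such that
`P(A) ≤ ε'` forces `‖∫_A F_{v,f}‖ ≤ ε₁ (E.δ/ρ)^α` for events `A` measurable off the ball. Proof: the
linear envelope `linearLocalEnvelope_rsw` with `ε' = ε₁ / (|C| + 1)`. -/
theorem localInnerEnvelopeUI_rsw : ∃ α : ℝ, 0 < α ∧ ∀ ε₁ > (0:ℝ), ∃ ε' > (0:ℝ), ∀ (E : DiscreteDobrushin), E.IsZdAdmissible → ∀ v f : Site 2, IsCorner v f → ∀ ρ : ℝ, E.δ ≤ ρ → closedBall (meshPoint E.δ v) ρ ⊆ E.Ω → ∀ A : Set (BondConfig (Site 2)), MeasurableSet[MeasurableSpace.comap (fun ω : BondConfig (Site 2) => ω \ {e | medialPoint E.δ e ∈ ball (meshPoint E.δ v) ρ}) (inferInstance : MeasurableSpace (BondConfig (Site 2)))] A → (bondPercolation (zdGraph 2) half).real A ≤ ε' → ‖∫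 ω in A, dartPhaseSum (medialExploration E ω) E.δ (1 / 3) (v, f) ∂(bondPercolation (zdGraph 2) half)‖ ≤ ε₁ * (E.δ / ρ) ^ α := by
  obtain ⟨C, α, hα, hC⟩ := linearLocalEnvelope_rsw
  refine ⟨α, hα, fun ε₁ hε₁ => ⟨ε₁ / (|C| + 1), by positivity, fun E hE v f hvf ρ hρ hball A hA hPA => ?_⟩⟩
  have hδ : 0 < E.δ := hE.delta_pos
  have hρpos : 0 < ρ := lt_of_lt_of_le hδ hρ
  have hr : 0 ≤ (E.δ / ρ) ^ α := Real.rpow_nonneg (div_nonneg hδ.le hρpos.le) _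
  have hP0 : 0 ≤ (bondPercolation (zdGraph 2) half).real A := measureReal_nonneg
  have key := hC E hE v f hvf ρ hρ hball A hA
  have h1 : C * (bondPercolation (zdGraph 2) half).real A ≤ |C| * (ε₁ / (|C| + 1)) :=
    (mul_le_mul_of_nonneg_right (le_abs_self C) hP0).trans (mul_le_mul_of_nonneg_left hPA (abs_nonneg C))
  have h2 : |C| * (ε₁ / (|C| + 1)) ≤ ε₁ := by
    rw [mul_div_assoc', div_le_iff₀ (by positivity)]
    nlinarith [abs_nonneg C]
  calc ‖∫ ω in A, dartPhaseSum (medialExploration E ω) E.δ (1 / 3) (v, f) ∂(bondPercolation (zdGraph 2) half)‖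
      ≤ C * (bondPercolation (zdGraph 2) half).real A * (E.δ / ρ) ^ α := key
    _ ≤ ε₁ * (E.δ / ρ) ^ α := mul_le_mul_of_nonneg_right (h1.trans h2) hr

end

end Summit.CriticalPhenomena.CardyFormulaZ2.Cruxes.EdgePrecompact.QkzStripBoundaryArm
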